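import Mathlib.Algebra.MvPolynomial.Monad
import Mathlib.Data.Fin.VecNotation
import Mathlib.RingTheory.Ideal.Operations
import HarnessLib

/-!
# [OURS · L1 W4.5(b) · EL♮(3)] Specimen N7 — the NESTED SECTIONS `C₁ ⊂ E_S`, `C₂ ⊂ E_{C₁}` along `σ_S`: chart identities of the
# tower P · CAR · Bl σ_S · Bl C₁ · Bl C₂ (kill side, res-L1-w45b-lead-1 POST-P6-CENSUS v1.3 §5e; crux `EquisingularLiftNatThree`,
# stmt-ResolutionOfSingularities-20148)

NOT a statement of any manuscript; OURS kernel specimen (cell `res-hironaka`, chain w45b, seat res-L1-w45b-lead-1 g17).  AI-written, weaker than expert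
review.  Nothing of [Hironaka2017] is asserted; EL♮(3) is NOT proved here; this file does NOT prove that N7 is outside any typed cut — it certifies the
chart algebra behind the by-hand claim «N7 needs a hosted round inside the exceptional divisor of a hosted round».

THE OBJECT.  `N7 = V(f)`, `f = (x² + y²z)² + z⁸ + x⁶ + xy¹⁰ + x¹² + y¹² + z¹²` (an «umbrella tail of L-order 4» behind S10; frame-bound non-ND certificate =
`not_isLocallyNewtonNondegenerate_N7` in `…NatSqEdgeFamilyDeepTails`).  Along the singular line's section `σ_S = E₁ ∩ St S` the transversal type is `A₅`, so after the
round at `σ_S` the strict transform is singular along a section `C₁` of `E_S`, after the round at `C₁` along a section `C₂` of `E_{C₁}` which does NOT meet `St E_S`, and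
the round at `C₂` separates the two branches.  Below, every move is ONE affine chart substitution (atlas7 conventions: `P` chart `S.y` is `x = X₀X₁, y = X₁, z = X₂X₁`;
`CAR` chart `E1.x` is `X₁ ↦ X₁X₀`; the `v`-chart of the blow-up of an ideal `(g, X₁)` is `g ↦ g'·X₁`), and every statement is a `ring` identity over an ARBITRARY
commutative ring `R` or an explicit ideal-membership witness:
* `total_P_Sy`      : `f ∘ (P:S.y) = X₁⁴ · F₁`,  `F₁ = (X₀² + X₁X₂)² + X₁⁴X₂⁸ + X₀⁶X₁² + X₀X₁⁷ + X₀¹²X₁⁸ + X₁⁸ + X₁⁸X₂¹²`;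
* `total_CAR_E1x`   : `F₁ ∘ (CAR:E1.x) = X₀² · F₂`, `F₂ = (X₀ + X₁X₂)² + X₀²X₁⁴X₂⁸ + X₀⁶X₁² + X₀⁶X₁⁷ + X₀¹⁸X₁⁸ + X₀⁶X₁⁸ + X₀⁶X₁⁸X₂¹²` — here `E₁ = V(X₀)`, `St S = V(X₁)`,
  `σ_S = V(X₀, X₁)`, and `X₀ + X₁X₂ = St²W_q` is the approximate root; `F₂ ∈ (X₀, X₁)²` (`mem_sq_SIG`);
* `total_SIG_v`     : `F₂(X₀X₁, X₁, X₂) = X₁² · F₃`, `F₃ = (X₀ + X₂)² + X₀²X₁⁴X₂⁸ + X₀⁶X₁⁶ + X₀⁶X₁¹¹ + X₀¹⁸X₁²⁴ + X₀⁶X₁¹² + X₀⁶X₁¹²X₂¹²` — here `E_S = V(X₁)` and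
  `F₃|_{E_S} = (X₀ + X₂)²` (`restrict_ES`): the strict transform meets `E_S` in the DOUBLED SECTION `C₁ = V(X₀ + X₂, X₁)` (the graph `ū = −w`, no letter); `F₃ ∈ (X₀ + X₂, X₁)²`
  (`mem_sq_C1`);
* `total_C1_v`      : `F₃(X₀X₁ − X₂, X₁, X₂) = X₁² · F₄`, `F₄ = X₀² + X₁²·G₄` with `G₄` explicit — here `E_{C₁} = V(X₁)`, `F₄|_{E_{C₁}} = X₀²` (`restrict_EC1`): the DOUBLED
  SECTION `C₂ = V(X₀, X₁)`; `F₄ ∈ (X₀, X₁)²` (`mem_sq_C2`);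
* `total_C1_u`      : the OTHER chart of the same round, `F₃(X₀, X₁(X₀ + X₂), X₂) = (X₀ + X₂)² · F₄ᵇ`, `F₄ᵇ = 1 + (X₀ + X₂)²·G₄ᵇ` — here `E_{C₁} = V(X₀ + X₂)` and `St E_S = V(X₁)`:
  the strict transform does not meet `E_{C₁}` in this chart at all (`restrict_EC1_u`: `F₄ᵇ ≡ 1 mod (X₀ + X₂)`), so `C₂ ∩ St E_S = ∅` — `C₂`'s only exceptional host is `E_{C₁}`;
* `total_C2_v`      : `F₄(X₀X₁, X₁, X₂) = X₁² · F₅`, `F₅|_{E_{C₂}} = X₀² + X₂¹⁰` (`restrict_EC2`): two reduced branches over every `w = X₂ ≠ 0` (char ≠ 2) — the third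
  round resolves the transversal `A₁`.
Measured counterpart: kit j320189 (`m7/tower/tower.sage`: low forms `a² + w⁸a²b⁴ − 2w⁹ab⁵ + w¹⁰b⁶ → a² + w¹⁰b⁴ → a² + w¹⁰b²`) and kit j320301 (this file's polynomials).
The `φ_q` / `σ∗` rounds of the P⁶ word have centres over `w = 0` and are omitted (isomorphisms over `w ≠ 0`).  By type, `…NatResidueHypDefs8`'s (HR) clause lists
`[St E₁]` only after a hosted round, so a round at `C₂ ⊂ E_{C₁}` has no listed host — the by-hand point of §5e; nothing about that is proved HERE.
-/

set_option linter.dupNamespace false -- mandated namespace `Summit.<Summit>.<Problem>` of this single-conjunct summit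

noncomputable section

open MvPolynomial

namespace Summit.ResolutionOfSingularities.ResolutionOfSingularities.Cruxes.EquisingularLiftNat.Sections

namespace SpecimenN7

variable (R : Type) [CommRing R]

/-! ## Move `P` (point step at `x₀`), chart `S.y` -/

/-- [OURS · L1 W4.5b] `f ∘ (P:S.y) = X₁⁴ · F₁`: the point step at `x₀`, chart `S.y` (`x = X₀X₁, y = X₁, z = X₂X₁`); `E_{x₀} = S = V(X₁)`, multiplicity `4`. [folklore] -/
theorem total_P_Sy :
    bind₁ (![X 0 * X 1, X 1, X 2 * X 1] : Fin 3 → MvPolynomial (Fin 3) R)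
        (((X 0 ^ 2 + X 1 ^ 2 * X 2) ^ 2 + (X 2 ^ 8 + X 0 ^ 6 + X 0 * X 1 ^ 10 + X 0 ^ 12 + X 1 ^ 12 + X 2 ^ 12)) : MvPolynomial (Fin 3) R) =
      X 1 ^ 4 * ((X 0 ^ 2 + X 1 * X 2) ^ 2 + X 1 ^ 4 * X 2 ^ 8 + X 0 ^ 6 * X 1 ^ 2 + X 0 * X 1 ^ 7 + X 0 ^ 12 * X 1 ^ 8 + X 1 ^ 8 + X 1 ^ 8 * X 2 ^ 12) := by
  simp only [map_add, map_pow, map_mul, bind₁_X_right]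
  simp only [Matrix.cons_val_zero, Matrix.cons_val_one, Matrix.cons_val_two, Matrix.tail_cons, Matrix.head_cons]
  ring

/-! ## Move `CAR` (carrier round along `L̃ = S ∩ St Π`), chart `E1.x` -/

/-- [OURS · L1 W4.5b] `F₁ ∘ (CAR:E1.x) = X₀² · F₂` (`X₁ ↦ X₁X₀`; `E₁ = V(X₀)`, multiplicity `2` along the carrier).  `F₂ = (X₀ + X₁X₂)² + …`: the square of the
approximate root `U = X₀ + X₁X₂` plus terms of `(X₀, X₁)`-order `≥ 6`. [folklore] -/
theorem total_CAR_E1x :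
    bind₁ (![X 0, X 1 * X 0, X 2] : Fin 3 → MvPolynomial (Fin 3) R)
        (((X 0 ^ 2 + X 1 * X 2) ^ 2 + X 1 ^ 4 * X 2 ^ 8 + X 0 ^ 6 * X 1 ^ 2 + X 0 * X 1 ^ 7 + X 0 ^ 12 * X 1 ^ 8 + X 1 ^ 8 + X 1 ^ 8 * X 2 ^ 12) : MvPolynomial (Fin 3) R) =
      X 0 ^ 2 * ((X 0 + X 1 * X 2) ^ 2 + X 0 ^ 2 * X 1 ^ 4 * X 2 ^ 8 + X 0 ^ 6 * X 1 ^ 2 + X 0 ^ 6 * X 1 ^ 7 + X 0 ^ 18 * X 1 ^ 8 + X 0 ^ 6 * X 1 ^ 8 +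
        X 0 ^ 6 * X 1 ^ 8 * X 2 ^ 12) := by
  simp only [map_add, map_pow, map_mul, bind₁_X_right]
  simp only [Matrix.cons_val_zero, Matrix.cons_val_one, Matrix.cons_val_two, Matrix.tail_cons, Matrix.head_cons]
  ring

/-- [OURS · L1 W4.5b] `F₂ ∈ (X₀, X₁)²`: the strict transform after `CAR` is singular along `σ_S = E₁ ∩ St S = V(X₀, X₁)` — explicit witness
`F₂ = X₀²·a + X₀X₁·b + X₁²·c`. [folklore] -/
theorem mem_sq_SIG :
    ((X 0 + X 1 * X 2) ^ 2 + X 0 ^ 2 * X 1 ^ 4 * X 2 ^ 8 + X 0 ^ 6 * X 1 ^ 2 + X 0 ^ 6 * X 1 ^ 7 + X 0 ^ 18 * X 1 ^ 8 + X 0 ^ 6 * X 1 ^ 8 +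
        X 0 ^ 6 * X 1 ^ 8 * X 2 ^ 12 : MvPolynomial (Fin 3) R) ∈ (Ideal.span {X 0, X 1} : Ideal (MvPolynomial (Fin 3) R)) ^ 2 := by
  have h : ((X 0 + X 1 * X 2) ^ 2 + X 0 ^ 2 * X 1 ^ 4 * X 2 ^ 8 + X 0 ^ 6 * X 1 ^ 2 + X 0 ^ 6 * X 1 ^ 7 + X 0 ^ 18 * X 1 ^ 8 + X 0 ^ 6 * X 1 ^ 8 +
        X 0 ^ 6 * X 1 ^ 8 * X 2 ^ 12 : MvPolynomial (Fin 3) R) =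
      X 0 * X 0 * (1 + X 1 ^ 4 * X 2 ^ 8 + X 0 ^ 4 * X 1 ^ 2 + X 0 ^ 4 * X 1 ^ 7 + X 0 ^ 16 * X 1 ^ 8 + X 0 ^ 4 * X 1 ^ 8 + X 0 ^ 4 * X 1 ^ 8 * X 2 ^ 12) +
        X 0 * X 1 * (2 * X 2) + X 1 * X 1 * (X 2 ^ 2) := by ring
  rw [h, pow_two]
  have h0 : (X 0 : MvPolynomial (Fin 3) R) ∈ Ideal.span ({X 0, X 1} : Set (MvPolynomial (Fin 3) R)) := Ideal.subset_span (by simp)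
  have h1 : (X 1 : MvPolynomial (Fin 3) R) ∈ Ideal.span ({X 0, X 1} : Set (MvPolynomial (Fin 3) R)) := Ideal.subset_span (by simp)
  refine Ideal.add_mem _ (Ideal.add_mem _ ?_ ?_) ?_
  · exact Ideal.mul_mem_right _ _ (Ideal.mul_mem_mul h0 h0)
  · exact Ideal.mul_mem_right _ _ (Ideal.mul_mem_mul h0 h1)
  · exact Ideal.mul_mem_right _ _ (Ideal.mul_mem_mul h1 h1)

/-! ## The round at `σ_S`, `v`-chart (`X₀ ↦ X₀X₁`): the section `C₁ ⊂ E_S` -/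

/-- [OURS · L1 W4.5b] `F₂(X₀X₁, X₁, X₂) = X₁² · F₃` (`E_S = V(X₁)`, multiplicity `2` along `σ_S`); `F₃ = (X₀ + X₂)² + (terms in X₁⁴)`. [folklore] -/
theorem total_SIG_v :
    bind₁ (![X 0 * X 1, X 1, X 2] : Fin 3 → MvPolynomial (Fin 3) R)
        ((X 0 + X 1 * X 2) ^ 2 + X 0 ^ 2 * X 1 ^ 4 * X 2 ^ 8 + X 0 ^ 6 * X 1 ^ 2 + X 0 ^ 6 * X 1 ^ 7 + X 0 ^ 18 * X 1 ^ 8 + X 0 ^ 6 * X 1 ^ 8 +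
          X 0 ^ 6 * X 1 ^ 8 * X 2 ^ 12 : MvPolynomial (Fin 3) R) =
      X 1 ^ 2 * ((X 0 + X 2) ^ 2 + X 0 ^ 2 * X 1 ^ 4 * X 2 ^ 8 + X 0 ^ 6 * X 1 ^ 6 + X 0 ^ 6 * X 1 ^ 11 + X 0 ^ 18 * X 1 ^ 24 + X 0 ^ 6 * X 1 ^ 12 +
        X 0 ^ 6 * X 1 ^ 12 * X 2 ^ 12) := by
  simp only [map_add, map_pow, map_mul, bind₁_X_right]
  simp only [Matrix.cons_val_zero, Matrix.cons_val_one, Matrix.cons_val_two, Matrix.tail_cons, Matrix.head_cons]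
  ring

/-- [OURS · L1 W4.5b] `F₃|_{E_S} = (X₀ + X₂)²`: setting `X₁ = 0`, the strict transform meets `E_S` in the DOUBLED section `C₁ = V(X₀ + X₂, X₁)` (transversal `A₃`
after the round; `C₁` is the graph `ū = −w`, contained in no letter). [folklore] -/
theorem restrict_ES :
    bind₁ (![X 0, 0, X 2] : Fin 3 → MvPolynomial (Fin 3) R)
        ((X 0 + X 2) ^ 2 + X 0 ^ 2 * X 1 ^ 4 * X 2 ^ 8 + X 0 ^ 6 * X 1 ^ 6 + X 0 ^ 6 * X 1 ^ 11 + X 0 ^ 18 * X 1 ^ 24 + X 0 ^ 6 * X 1 ^ 12 +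
          X 0 ^ 6 * X 1 ^ 12 * X 2 ^ 12 : MvPolynomial (Fin 3) R) = (X 0 + X 2) ^ 2 := by
  simp only [map_add, map_pow, map_mul, bind₁_X_right]
  simp only [Matrix.cons_val_zero, Matrix.cons_val_one, Matrix.cons_val_two, Matrix.tail_cons, Matrix.head_cons]
  ring

/-- [OURS · L1 W4.5b] `F₃ ∈ (X₀ + X₂, X₁)²`: the strict transform after the `σ_S` round is singular along the section `C₁`. [folklore] -/
theorem mem_sq_C1 :
    ((X 0 + X 2) ^ 2 + X 0 ^ 2 * X 1 ^ 4 * X 2 ^ 8 + X 0 ^ 6 * X 1 ^ 6 + X 0 ^ 6 * X 1 ^ 11 + X 0 ^ 18 * X 1 ^ 24 + X 0 ^ 6 * X 1 ^ 12 +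
        X 0 ^ 6 * X 1 ^ 12 * X 2 ^ 12 : MvPolynomial (Fin 3) R) ∈ (Ideal.span {X 0 + X 2, X 1} : Ideal (MvPolynomial (Fin 3) R)) ^ 2 := by
  have h : ((X 0 + X 2) ^ 2 + X 0 ^ 2 * X 1 ^ 4 * X 2 ^ 8 + X 0 ^ 6 * X 1 ^ 6 + X 0 ^ 6 * X 1 ^ 11 + X 0 ^ 18 * X 1 ^ 24 + X 0 ^ 6 * X 1 ^ 12 +
        X 0 ^ 6 * X 1 ^ 12 * X 2 ^ 12 : MvPolynomial (Fin 3) R) =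
      (X 0 + X 2) * (X 0 + X 2) * 1 +
        X 1 * X 1 * (X 0 ^ 2 * X 1 ^ 2 * X 2 ^ 8 + X 0 ^ 6 * X 1 ^ 4 + X 0 ^ 6 * X 1 ^ 9 + X 0 ^ 18 * X 1 ^ 22 + X 0 ^ 6 * X 1 ^ 10 +
          X 0 ^ 6 * X 1 ^ 10 * X 2 ^ 12) := by ring
  rw [h, pow_two]
  have h0 : (X 0 + X 2 : MvPolynomial (Fin 3) R) ∈ Ideal.span ({X 0 + X 2, X 1} : Set (MvPolynomial (Fin 3) R)) := Ideal.subset_span (by simp)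
  have h1 : (X 1 : MvPolynomial (Fin 3) R) ∈ Ideal.span ({X 0 + X 2, X 1} : Set (MvPolynomial (Fin 3) R)) := Ideal.subset_span (by simp)
  refine Ideal.add_mem _ ?_ ?_
  · exact Ideal.mul_mem_right _ _ (Ideal.mul_mem_mul h0 h0)
  · exact Ideal.mul_mem_right _ _ (Ideal.mul_mem_mul h1 h1)

/-! ## The round at `C₁`, `v`-chart (`X₀ + X₂ ↦ X₀X₁`, i.e. `X₀ ↦ X₀X₁ − X₂`): the section `C₂ ⊂ E_{C₁}` -/

/-- [OURS · L1 W4.5b] `F₃(X₀X₁ − X₂, X₁, X₂) = X₁² · F₄` (`E_{C₁} = V(X₁)`, multiplicity `2` along `C₁`); `F₄ = X₀² + X₁²·G₄` with the approximate root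
now the COORDINATE `X₀` and `S := X₀X₁ − X₂` carrying the tail. [folklore] -/
theorem total_C1_v :
    bind₁ (![X 0 * X 1 - X 2, X 1, X 2] : Fin 3 → MvPolynomial (Fin 3) R)
        ((X 0 + X 2) ^ 2 + X 0 ^ 2 * X 1 ^ 4 * X 2 ^ 8 + X 0 ^ 6 * X 1 ^ 6 + X 0 ^ 6 * X 1 ^ 11 + X 0 ^ 18 * X 1 ^ 24 + X 0 ^ 6 * X 1 ^ 12 +
          X 0 ^ 6 * X 1 ^ 12 * X 2 ^ 12 : MvPolynomial (Fin 3) R) =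
      X 1 ^ 2 * (X 0 ^ 2 + X 1 ^ 2 * ((X 0 * X 1 - X 2) ^ 2 * X 2 ^ 8 + X 1 ^ 2 * (X 0 * X 1 - X 2) ^ 6 + X 1 ^ 7 * (X 0 * X 1 - X 2) ^ 6 +
        X 1 ^ 20 * (X 0 * X 1 - X 2) ^ 18 + X 1 ^ 8 * (X 0 * X 1 - X 2) ^ 6 + X 1 ^ 8 * (X 0 * X 1 - X 2) ^ 6 * X 2 ^ 12)) := by
  simp only [map_add, map_pow, map_mul, bind₁_X_right]
  simp only [Matrix.cons_val_zero, Matrix.cons_val_one, Matrix.cons_val_two, Matrix.tail_cons, Matrix.head_cons]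
  ring

/-- [OURS · L1 W4.5b] `F₄|_{E_{C₁}} = X₀²`: the strict transform meets `E_{C₁}` in the DOUBLED section `C₂ = V(X₀, X₁)` (transversal `A₁` remains). [folklore] -/
theorem restrict_EC1 :
    bind₁ (![X 0, 0, X 2] : Fin 3 → MvPolynomial (Fin 3) R)
        (X 0 ^ 2 + X 1 ^ 2 * ((X 0 * X 1 - X 2) ^ 2 * X 2 ^ 8 + X 1 ^ 2 * (X 0 * X 1 - X 2) ^ 6 + X 1 ^ 7 * (X 0 * X 1 - X 2) ^ 6 +
          X 1 ^ 20 * (X 0 * X 1 - X 2) ^ 18 + X 1 ^ 8 * (X 0 * X 1 - X 2) ^ 6 + X 1 ^ 8 * (X 0 * X 1 - X 2) ^ 6 * X 2 ^ 12) : MvPolynomial (Fin 3) R) =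
      X 0 ^ 2 := by
  simp only [map_add, map_sub, map_pow, map_mul, bind₁_X_right]
  simp only [Matrix.cons_val_zero, Matrix.cons_val_one, Matrix.cons_val_two, Matrix.tail_cons, Matrix.head_cons]
  ring

/-- [OURS · L1 W4.5b] `F₄ ∈ (X₀, X₁)²`: the strict transform after the round at `C₁` is STILL singular along a curve, the section `C₂ = V(X₀, X₁)` of
`E_{C₁} = V(X₁)`. [folklore] -/
theorem mem_sq_C2 :
    (X 0 ^ 2 + X 1 ^ 2 * ((X 0 * X 1 - X 2) ^ 2 * X 2 ^ 8 + X 1 ^ 2 * (X 0 * X 1 - X 2) ^ 6 + X 1 ^ 7 * (X 0 * X 1 - X 2) ^ 6 +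
        X 1 ^ 20 * (X 0 * X 1 - X 2) ^ 18 + X 1 ^ 8 * (X 0 * X 1 - X 2) ^ 6 + X 1 ^ 8 * (X 0 * X 1 - X 2) ^ 6 * X 2 ^ 12) : MvPolynomial (Fin 3) R) ∈
      (Ideal.span {X 0, X 1} : Ideal (MvPolynomial (Fin 3) R)) ^ 2 := by
  rw [pow_two (Ideal.span _)]
  have h0 : (X 0 : MvPolynomial (Fin 3) R) ∈ Ideal.span ({X 0, X 1} : Set (MvPolynomial (Fin 3) R)) := Ideal.subset_span (by simp)
  have h1 : (X 1 : MvPolynomial (Fin 3) R) ∈ Ideal.span ({X 0, X 1} : Set (MvPolynomial (Fin 3) R)) := Ideal.subset_span (by simp)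
  refine Ideal.add_mem _ ?_ ?_
  · rw [pow_two]; exact Ideal.mul_mem_mul h0 h0
  · rw [pow_two]; exact Ideal.mul_mem_right _ _ (Ideal.mul_mem_mul h1 h1)

/-! ## The round at `C₁`, the OTHER chart (`X₁ ↦ X₁(X₀ + X₂)`): `C₂` does not meet `St E_S` -/

/-- [OURS · L1 W4.5b] `F₃(X₀, X₁(X₀ + X₂), X₂) = (X₀ + X₂)² · F₄ᵇ` with `F₄ᵇ = 1 + (X₀ + X₂)²X₁⁴·G₄ᵇ` (`E_{C₁} = V(X₀ + X₂)`, `St E_S = V(X₁)` in this chart). [folklore] -/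
theorem total_C1_u :
    bind₁ (![X 0, X 1 * (X 0 + X 2), X 2] : Fin 3 → MvPolynomial (Fin 3) R)
        ((X 0 + X 2) ^ 2 + X 0 ^ 2 * X 1 ^ 4 * X 2 ^ 8 + X 0 ^ 6 * X 1 ^ 6 + X 0 ^ 6 * X 1 ^ 11 + X 0 ^ 18 * X 1 ^ 24 + X 0 ^ 6 * X 1 ^ 12 +
          X 0 ^ 6 * X 1 ^ 12 * X 2 ^ 12 : MvPolynomial (Fin 3) R) =
      (X 0 + X 2) ^ 2 * (1 + (X 0 + X 2) ^ 2 * X 1 ^ 4 * (X 0 ^ 2 * X 2 ^ 8 + X 0 ^ 6 * X 1 ^ 2 * (X 0 + X 2) ^ 2 +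
        X 0 ^ 6 * X 1 ^ 7 * (X 0 + X 2) ^ 7 + X 0 ^ 18 * X 1 ^ 20 * (X 0 + X 2) ^ 20 + X 0 ^ 6 * X 1 ^ 8 * (X 0 + X 2) ^ 8 +
        X 0 ^ 6 * X 1 ^ 8 * (X 0 + X 2) ^ 8 * X 2 ^ 12)) := by
  simp only [map_add, map_pow, map_mul, bind₁_X_right]
  simp only [Matrix.cons_val_zero, Matrix.cons_val_one, Matrix.cons_val_two, Matrix.tail_cons, Matrix.head_cons]
  ring

/-- [OURS · L1 W4.5b] `F₄ᵇ ≡ 1` on `E_{C₁} = V(X₀ + X₂)`: substituting `X₂ = −X₀`, the strict transform's chart equation becomes `1` — NO point of the strict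
transform lies on `E_{C₁}` in this chart; in particular `C₂ ∩ St E_S = ∅` (`St E_S = V(X₁)` lives here), so `C₂`'s only exceptional host is `E_{C₁}`. [folklore] -/
theorem restrict_EC1_u :
    bind₁ (![X 0, X 1, -X 0] : Fin 3 → MvPolynomial (Fin 3) R)
        (1 + (X 0 + X 2) ^ 2 * X 1 ^ 4 * (X 0 ^ 2 * X 2 ^ 8 + X 0 ^ 6 * X 1 ^ 2 * (X 0 + X 2) ^ 2 +
          X 0 ^ 6 * X 1 ^ 7 * (X 0 + X 2) ^ 7 + X 0 ^ 18 * X 1 ^ 20 * (X 0 + X 2) ^ 20 + X 0 ^ 6 * X 1 ^ 8 * (X 0 + X 2) ^ 8 +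
          X 0 ^ 6 * X 1 ^ 8 * (X 0 + X 2) ^ 8 * X 2 ^ 12) : MvPolynomial (Fin 3) R) = 1 := by
  simp only [map_add, map_pow, map_mul, map_one, bind₁_X_right]
  simp only [Matrix.cons_val_zero, Matrix.cons_val_one, Matrix.cons_val_two, Matrix.tail_cons, Matrix.head_cons]
  ring

/-! ## The round at `C₂`, `v`-chart (`X₀ ↦ X₀X₁`): the branches separate -/

/-- [OURS · L1 W4.5b] `F₄(X₀X₁, X₁, X₂) = X₁² · F₅` (`E_{C₂} = V(X₁)`, multiplicity `2` along `C₂`). [folklore] -/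
theorem total_C2_v :
    bind₁ (![X 0 * X 1, X 1, X 2] : Fin 3 → MvPolynomial (Fin 3) R)
        (X 0 ^ 2 + X 1 ^ 2 * ((X 0 * X 1 - X 2) ^ 2 * X 2 ^ 8 + X 1 ^ 2 * (X 0 * X 1 - X 2) ^ 6 + X 1 ^ 7 * (X 0 * X 1 - X 2) ^ 6 +
          X 1 ^ 20 * (X 0 * X 1 - X 2) ^ 18 + X 1 ^ 8 * (X 0 * X 1 - X 2) ^ 6 + X 1 ^ 8 * (X 0 * X 1 - X 2) ^ 6 * X 2 ^ 12) : MvPolynomial (Fin 3) R) =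
      X 1 ^ 2 * (X 0 ^ 2 + ((X 0 * X 1 ^ 2 - X 2) ^ 2 * X 2 ^ 8 + X 1 ^ 2 * (X 0 * X 1 ^ 2 - X 2) ^ 6 + X 1 ^ 7 * (X 0 * X 1 ^ 2 - X 2) ^ 6 +
        X 1 ^ 20 * (X 0 * X 1 ^ 2 - X 2) ^ 18 + X 1 ^ 8 * (X 0 * X 1 ^ 2 - X 2) ^ 6 + X 1 ^ 8 * (X 0 * X 1 ^ 2 - X 2) ^ 6 * X 2 ^ 12)) := by
  simp only [map_add, map_sub, map_pow, map_mul, bind₁_X_right]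
  simp only [Matrix.cons_val_zero, Matrix.cons_val_one, Matrix.cons_val_two, Matrix.tail_cons, Matrix.head_cons]
  ring

/-- [OURS · L1 W4.5b] `F₅|_{E_{C₂}} = X₀² + X₂¹⁰`: over every `w = X₂ ≠ 0` the strict transform meets `E_{C₂}` in the two REDUCED branches `X₀ = ± √(−X₂¹⁰)` (char ≠ 2)
— the transversal `A₁` is resolved by the third round; the doubled structure survives only over `w = 0` (the B-trace point over `q`, served by the `φ_q`/`σ∗` rounds).
[folklore] -/
theorem restrict_EC2 :
    bind₁ (![X 0, 0, X 2] : Fin 3 → MvPolynomial (Fin 3) R)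
        (X 0 ^ 2 + ((X 0 * X 1 ^ 2 - X 2) ^ 2 * X 2 ^ 8 + X 1 ^ 2 * (X 0 * X 1 ^ 2 - X 2) ^ 6 + X 1 ^ 7 * (X 0 * X 1 ^ 2 - X 2) ^ 6 +
          X 1 ^ 20 * (X 0 * X 1 ^ 2 - X 2) ^ 18 + X 1 ^ 8 * (X 0 * X 1 ^ 2 - X 2) ^ 6 + X 1 ^ 8 * (X 0 * X 1 ^ 2 - X 2) ^ 6 * X 2 ^ 12) : MvPolynomial (Fin 3) R) =
      X 0 ^ 2 + X 2 ^ 10 := by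
  simp only [map_add, map_sub, map_pow, map_mul, bind₁_X_right]
  simp only [Matrix.cons_val_zero, Matrix.cons_val_one, Matrix.cons_val_two, Matrix.tail_cons, Matrix.head_cons]
  ring

/-! ## (g1, appended) The EVERY-FRAME inputs at `x₀`: `L ⊆ Sing H₁` in both charts meeting `L`, and the tangent cone `(x₁² + yz₁)²` at `q`
These are the two ring facts consumed by res-L1-w45b-lead-1's RESIDUE-CUSTOMER-S10 §3 Lemma (B) (by hand, characteristic-free): a LINE of `Sing(Bl_{x₀}H) ∩ E`
through a point `q` where the tangent cone of `H₁` is `P²` with `P` a quadratic form of rank `3` forces «locally Newton-nondegenerate in NO chart and NO origin-fixing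
frame».  For N7: `F₁ ∈ (X₀, X₁)²` in chart `S.y` and `F₁ᶻ ∈ (X₀, X₂)²` in chart `S.z` (`L = E ∩ St Π` is covered by these two charts), and at `q = (0:1:0)` = the
origin of chart `S.y`, `F₁ = (X₀² + X₁X₂)² + R` with `R ∈ 𝔪⁸`, `𝔪 = (X₀, X₁, X₂)` — so the tangent cone is the DOUBLE of the rank-3 quadric cone `X₀² + X₁X₂`
(smooth conic in every characteristic, `2` included).  The Lemma itself is NOT typed here. -/

/-- [OURS · L1 W4.5b] `F₁ ∈ (X₀, X₁)²` in chart `S.y`: the line `L = V(X₀, X₁) = E ∩ St Π` lies in `Sing(H₁)` (explicit witness). [folklore] -/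
theorem mem_sq_L_Sy :
    ((X 0 ^ 2 + X 1 * X 2) ^ 2 + X 1 ^ 4 * X 2 ^ 8 + X 0 ^ 6 * X 1 ^ 2 + X 0 * X 1 ^ 7 + X 0 ^ 12 * X 1 ^ 8 + X 1 ^ 8 + X 1 ^ 8 * X 2 ^ 12 :
        MvPolynomial (Fin 3) R) ∈ (Ideal.span {X 0, X 1} : Ideal (MvPolynomial (Fin 3) R)) ^ 2 := by
  have h : ((X 0 ^ 2 + X 1 * X 2) ^ 2 + X 1 ^ 4 * X 2 ^ 8 + X 0 ^ 6 * X 1 ^ 2 + X 0 * X 1 ^ 7 + X 0 ^ 12 * X 1 ^ 8 + X 1 ^ 8 + X 1 ^ 8 * X 2 ^ 12 :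
        MvPolynomial (Fin 3) R) =
      X 0 * X 0 * (X 0 ^ 2 + X 0 ^ 4 * X 1 ^ 2 + X 0 ^ 10 * X 1 ^ 8) + X 0 * X 1 * (2 * X 0 * X 2 + X 1 ^ 6) +
        X 1 * X 1 * (X 2 ^ 2 + X 1 ^ 2 * X 2 ^ 8 + X 1 ^ 6 + X 1 ^ 6 * X 2 ^ 12) := by ring
  rw [h, pow_two]
  have h0 : (X 0 : MvPolynomial (Fin 3) R) ∈ Ideal.span ({X 0, X 1} : Set (MvPolynomial (Fin 3) R)) := Ideal.subset_span (by simp)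
  have h1 : (X 1 : MvPolynomial (Fin 3) R) ∈ Ideal.span ({X 0, X 1} : Set (MvPolynomial (Fin 3) R)) := Ideal.subset_span (by simp)
  refine Ideal.add_mem _ (Ideal.add_mem _ ?_ ?_) ?_
  · exact Ideal.mul_mem_right _ _ (Ideal.mul_mem_mul h0 h0)
  · exact Ideal.mul_mem_right _ _ (Ideal.mul_mem_mul h0 h1)
  · exact Ideal.mul_mem_right _ _ (Ideal.mul_mem_mul h1 h1)

/-- [OURS · L1 W4.5b] Move `P`, chart `S.z` (`x = X₀X₂, y = X₁X₂, z = X₂`): `f ∘ (P:S.z) = X₂⁴ · F₁ᶻ`,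
`F₁ᶻ = (X₀² + X₁²X₂)² + X₂⁴ + X₀⁶X₂² + X₀X₁¹⁰X₂⁷ + X₀¹²X₂⁸ + X₁¹²X₂⁸ + X₂⁸`. [folklore] -/
theorem total_P_Sz :
    bind₁ (![X 0 * X 2, X 1 * X 2, X 2] : Fin 3 → MvPolynomial (Fin 3) R)
        (((X 0 ^ 2 + X 1 ^ 2 * X 2) ^ 2 + (X 2 ^ 8 + X 0 ^ 6 + X 0 * X 1 ^ 10 + X 0 ^ 12 + X 1 ^ 12 + X 2 ^ 12)) : MvPolynomial (Fin 3) R) =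
      X 2 ^ 4 * ((X 0 ^ 2 + X 1 ^ 2 * X 2) ^ 2 + X 2 ^ 4 + X 0 ^ 6 * X 2 ^ 2 + X 0 * X 1 ^ 10 * X 2 ^ 7 + X 0 ^ 12 * X 2 ^ 8 + X 1 ^ 12 * X 2 ^ 8 +
        X 2 ^ 8) := by
  simp only [map_add, map_pow, map_mul, bind₁_X_right]
  simp only [Matrix.cons_val_zero, Matrix.cons_val_one, Matrix.cons_val_two, Matrix.tail_cons, Matrix.head_cons]
  ring

/-- [OURS · L1 W4.5b] `F₁ᶻ ∈ (X₀, X₂)²` in chart `S.z`: there `L = V(X₀, X₂)` (`E = V(X₂)`, `St Π = V(X₀)`), again inside `Sing(H₁)` — so ALL of `L` is singular.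
[folklore] -/
theorem mem_sq_L_Sz :
    ((X 0 ^ 2 + X 1 ^ 2 * X 2) ^ 2 + X 2 ^ 4 + X 0 ^ 6 * X 2 ^ 2 + X 0 * X 1 ^ 10 * X 2 ^ 7 + X 0 ^ 12 * X 2 ^ 8 + X 1 ^ 12 * X 2 ^ 8 + X 2 ^ 8 :
        MvPolynomial (Fin 3) R) ∈ (Ideal.span {X 0, X 2} : Ideal (MvPolynomial (Fin 3) R)) ^ 2 := by
  have h : ((X 0 ^ 2 + X 1 ^ 2 * X 2) ^ 2 + X 2 ^ 4 + X 0 ^ 6 * X 2 ^ 2 + X 0 * X 1 ^ 10 * X 2 ^ 7 + X 0 ^ 12 * X 2 ^ 8 + X 1 ^ 12 * X 2 ^ 8 + X 2 ^ 8 :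
        MvPolynomial (Fin 3) R) =
      X 0 * X 0 * (X 0 ^ 2 + X 0 ^ 4 * X 2 ^ 2 + X 0 ^ 10 * X 2 ^ 8) + X 0 * X 2 * (2 * X 0 * X 1 ^ 2 + X 1 ^ 10 * X 2 ^ 6) +
        X 2 * X 2 * (X 1 ^ 4 + X 2 ^ 2 + X 1 ^ 12 * X 2 ^ 6 + X 2 ^ 6) := by ring
  rw [h, pow_two]
  have h0 : (X 0 : MvPolynomial (Fin 3) R) ∈ Ideal.span ({X 0, X 2} : Set (MvPolynomial (Fin 3) R)) := Ideal.subset_span (by simp)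
  have h2 : (X 2 : MvPolynomial (Fin 3) R) ∈ Ideal.span ({X 0, X 2} : Set (MvPolynomial (Fin 3) R)) := Ideal.subset_span (by simp)
  refine Ideal.add_mem _ (Ideal.add_mem _ ?_ ?_) ?_
  · exact Ideal.mul_mem_right _ _ (Ideal.mul_mem_mul h0 h0)
  · exact Ideal.mul_mem_right _ _ (Ideal.mul_mem_mul h0 h2)
  · exact Ideal.mul_mem_right _ _ (Ideal.mul_mem_mul h2 h2)

/-- [OURS · L1 W4.5b] plumbing: a product `a · b` with `a ∈ 𝔪^i`, `b ∈ 𝔪^j`, `8 ≤ i + j` lies in `𝔪⁸`. [folklore] -/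
theorem mul_mem_pow_eight {I : Ideal (MvPolynomial (Fin 3) R)} {a b : MvPolynomial (Fin 3) R} {i j : ℕ}
    (ha : a ∈ I ^ i) (hb : b ∈ I ^ j) (hij : 8 ≤ i + j) : a * b ∈ I ^ 8 :=
  Ideal.pow_le_pow_right hij (by rw [pow_add]; exact Ideal.mul_mem_mul ha hb)

/-- [OURS · L1 W4.5b] **Tangent cone at `q`.**  In chart `S.y` (origin = `q = (0:1:0)`), `F₁ = (X₀² + X₁X₂)² + R` with `R ∈ 𝔪⁸`, `𝔪 = (X₀, X₁, X₂)`: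
the tangent cone of `H₁` at `q` is `(X₀² + X₁X₂)²`, the double of a rank-3 quadric cone (all six tail terms have degree `≥ 8`). [folklore] -/
theorem tangentCone_q :
    ((X 0 ^ 2 + X 1 * X 2) ^ 2 + X 1 ^ 4 * X 2 ^ 8 + X 0 ^ 6 * X 1 ^ 2 + X 0 * X 1 ^ 7 + X 0 ^ 12 * X 1 ^ 8 + X 1 ^ 8 + X 1 ^ 8 * X 2 ^ 12 :
        MvPolynomial (Fin 3) R) - (X 0 ^ 2 + X 1 * X 2) ^ 2 ∈ (Ideal.span {X 0, X 1, X 2} : Ideal (MvPolynomial (Fin 3) R)) ^ 8 := by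
  have h : ((X 0 ^ 2 + X 1 * X 2) ^ 2 + X 1 ^ 4 * X 2 ^ 8 + X 0 ^ 6 * X 1 ^ 2 + X 0 * X 1 ^ 7 + X 0 ^ 12 * X 1 ^ 8 + X 1 ^ 8 + X 1 ^ 8 * X 2 ^ 12 :
        MvPolynomial (Fin 3) R) - (X 0 ^ 2 + X 1 * X 2) ^ 2 =
      X 1 ^ 4 * X 2 ^ 8 + X 0 ^ 6 * X 1 ^ 2 + X 0 * X 1 ^ 7 + X 0 ^ 12 * X 1 ^ 8 + X 1 ^ 8 * 1 + X 1 ^ 8 * X 2 ^ 12 := by ring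
  rw [h]
  set I : Ideal (MvPolynomial (Fin 3) R) := Ideal.span {X 0, X 1, X 2} with hI
  have h0 : (X 0 : MvPolynomial (Fin 3) R) ∈ I := Ideal.subset_span (by simp)
  have h1 : (X 1 : MvPolynomial (Fin 3) R) ∈ I := Ideal.subset_span (by simp)
  have h2 : (X 2 : MvPolynomial (Fin 3) R) ∈ I := Ideal.subset_span (by simp)
  have p0 : ∀ n : ℕ, (X 0 : MvPolynomial (Fin 3) R) ^ n ∈ I ^ n := fun n => Ideal.pow_mem_pow h0 n
  have p1 : ∀ n : ℕ, (X 1 : MvPolynomial (Fin 3) R) ^ n ∈ I ^ n := fun n => Ideal.pow_mem_pow h1 n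
  have p2 : ∀ n : ℕ, (X 2 : MvPolynomial (Fin 3) R) ^ n ∈ I ^ n := fun n => Ideal.pow_mem_pow h2 n
  have hX0 : (X 0 : MvPolynomial (Fin 3) R) ∈ I ^ 1 := by rw [pow_one]; exact h0
  have hone : (1 : MvPolynomial (Fin 3) R) ∈ I ^ 0 := by rw [pow_zero, Ideal.one_eq_top]; exact Submodule.mem_top
  refine Ideal.add_mem _ (Ideal.add_mem _ (Ideal.add_mem _ (Ideal.add_mem _ (Ideal.add_mem _ ?_ ?_) ?_) ?_) ?_) ?_
  · exact mul_mem_pow_eight R (p1 4) (p2 8) (by norm_num)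
  · exact mul_mem_pow_eight R (p0 6) (p1 2) (by norm_num)
  · exact mul_mem_pow_eight R hX0 (p1 7) (by norm_num)
  · exact mul_mem_pow_eight R (p0 12) (p1 8) (by norm_num)
  · exact mul_mem_pow_eight R (p1 8) hone (by norm_num)
  · exact mul_mem_pow_eight R (p1 8) (p2 12) (by norm_num)

end SpecimenN7

end Summit.ResolutionOfSingularities.ResolutionOfSingularities.Cruxes.EquisingularLiftNat.Sections

end
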